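import Summits.CriticalPhenomena.PercolationContinuityZ3.Theorems.PercAnnulusCrossingIICManyPointsOneScale
import HarnessLib

/-!
# Many points at one scale, II: the k-point function of Kesten's IIC in the shell `Λ(2n) ∖ Λ(n−1)` at `p_c(ℤ^d)` (lane RSW3, p1 gen 20)

builds on p205010 (kernel theorem, internal audit signed; external expert review pending) — NOT used in this file
(only `p_c(ℤ^d) > 0`).

RSW3 lane (LANE 3 `prim-rsw3`), seat `prim-rsw3-p1` (gen 20).  Helper file (`--supports stmt-CriticalPhenomena-4575`);
no definitions, no sorries.  Memo `run/shared/lean/prim/rsw3/P1-QM.md` §33.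

Part I (`…IICManyPointsOneScale`) proved, for every `d`, `p` under `CU⁺_l` + single-level UAD + the one-arm ratio bound, the quenched
k-point lower bound `c_U (π(128u)/(2B_l))^{#S} ν(H) ≤ ν(H ∩ ⋂_{z ∈ S}{0 ↔ z in Λ(128lu)})` for `S ⊆ Λ(128u) ∖ Λ(32u)`, `2b ≤ u`, `K₀b ≤ 16u`.
Here the hypotheses are discharged at `p_c(ℤ^d)` ((A2)□ gives the ratio bound, UAD the level `K₀`) and the shell is written as
`n ≤ ‖z‖_∞ ≤ 2n` (`u = ⌊(n−1)/32⌋`):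

* `div32_scale_bounds` — bookkeeping for `u = ⌊(n−1)/32⌋`;
* **`exists_iicMeasure_real_inter_biInter_openConnIn_ge_criticalProbI`** — at `p_c(ℤ^d)`, `d ≥ 2`, under (A2)□(s,L) + `CU⁺_l` + UAD:
  there are `n₀` and `c > 0` with **`c_U · (c·π_{p_c}(n))^{#S} · ν(H) ≤ ν(H ∩ ⋂_{z ∈ S}{0 ↔ z in Λ(4ln)})`** for all `b ≥ 1`, `n ≥ n₀ b`,
  all finite `S` with `n ≤ ‖z‖_∞ ≤ 2n` on `S`, and every local `H` reading only the cluster of the origin inside `Λ(b)`;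
* **`exists_iicMeasure_real_biInter_openConn_ge_criticalProbI`** — `H = univ`: **THE k-POINT FUNCTION OF KESTEN'S IIC AT ONE SCALE IS AT
  LEAST `c_U (c π_{p_c}(n))^k`, FOR ANY `k` SITES OF SUP-NORM IN `[n, 2n]`** — no separation between the sites (the matching upper bound
  `(Cπ(n))^k` needs separated sites).  Companion of gen 19's factorisation ACROSS separated scales.
References: H. Kesten, Probab. Theory Relat. Fields 73 (1986) Thm. (8); D. Basu, A. Sapozhnikov, ECP 22 (2017) Thm. 1.1.
-/

noncomputable section

namespace Summit.CriticalPhenomena.PercolationContinuityZ3.Theorems.Crossing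

open MeasureTheory Filter Topology Literature.Probability.Percolation Literature.Probability.LatticeModels
open Literature.Probability.Percolation.DCT16
open Summit.CriticalPhenomena.PercolationContinuityZ3.Theorems.SurfaceTension

variable {d : ℕ}

/-! ## §5 At `p_c(ℤ^d)` -/

/-- Scale bookkeeping for `u = ⌊(n−1)/32⌋`: if `32(K₀+3)b ≤ n` (`b ≥ 1`) then `2b ≤ u`, `K₀ b ≤ 16u`, `32u + 1 ≤ n`, `2n ≤ 128u` and
`128u ≤ 4n`. [folklore] -/
theorem div32_scale_bounds {K₀ b n : ℕ} (hb : 1 ≤ b) (hn : 32 * (K₀ + 3) * b ≤ n) :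
    2 * b ≤ (n - 1) / 32 ∧ K₀ * b ≤ 16 * ((n - 1) / 32) ∧ 32 * ((n - 1) / 32) + 1 ≤ n ∧ 2 * n ≤ 128 * ((n - 1) / 32) ∧
      128 * ((n - 1) / 32) ≤ 4 * n := by
  have h1 : 32 * ((n - 1) / 32) ≤ n - 1 := Nat.mul_div_le (n - 1) 32
  have h2 : n - 1 < 32 * ((n - 1) / 32) + 32 := by
    have := Nat.lt_div_mul_add (a := n - 1) (b := 32) (by norm_num)
    linarith
  have h96 : 96 * b ≤ n := le_trans (by nlinarith) hn
  have hK : 32 * (K₀ * b) + 96 * b ≤ n := by nlinarith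
  generalize (n - 1) / 32 = u at h1 h2 ⊢
  generalize K₀ * b = P at hK ⊢
  omega

/-- **THE k-POINT FUNCTION OF KESTEN'S IIC AT ONE SCALE, GIVEN THE INSIDE, ON `ℤ^d`** (`p_c(ℤ^d)`, `d ≥ 2`; (A2)□ at aspect `(s,L)`,
`2 ≤ s ≤ L`, `ϰ > 0`; `CU⁺_l(c_U)`, `l ≥ 2`, `c_U > 0`; UAD): there are `n₀ ≥ 1` and `c > 0` such that for every finite measure `ν` with
Kesten's IIC limit property at `p_c(ℤ^d)`, every inner scale `b ≥ 1`, every `n ≥ n₀ b`, every local event `H` reading only the cluster of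
the origin inside `Λ(b)`, and EVERY finite set of sites `S` with `n ≤ ‖z‖_∞ ≤ 2n` for `z ∈ S`:
**`c_U · (c·π_{p_c}(n))^{#S} · ν(H) ≤ ν(H ∩ ⋂_{z ∈ S}{0 ↔ z in Λ(4ln)})`** — no separation between the sites is required.
[cite: Kesten1986, Thm. (8)] [cite: BasuSapozhnikov2017ECP, Thm. 1.1] -/
theorem exists_iicMeasure_real_inter_biInter_openConnIn_ge_criticalProbI (hd : 2 ≤ d) {s L : ℕ} (hs : 2 ≤ s) (hsL : s ≤ L)
    {ϰ : ℝ} (hϰ : 0 < ϰ) (hA2 : SetToSetQuasiMultAspectAt d (criticalProbI d) s L ϰ) {l : ℕ} (hl : 2 ≤ l) {cU : ℝ} (hcU : 0 < cU)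
    (hCU : ∀ a : ℕ, 1 ≤ a → ∀ E : Set (BondConfig (Site d)), IsUpperSet E → MeasurableSet E →
      cU * (bondPercolation (zdGraph d) (criticalProbI d)).real E ≤ (bondPercolation (zdGraph d) (criticalProbI d)).real (E ∩
        {ω : BondConfig (Site d) | ∀ t ∈ innerBoundary (zdGraph d) (box d a), ∀ s ∈ innerBoundary (zdGraph d) (box d (l * a)),
          ∀ t' ∈ innerBoundary (zdGraph d) (box d a), ∀ s' ∈ innerBoundary (zdGraph d) (box d (l * a)),
          ω ∈ openConnIn (↑((box d (l * a) \ box d a) ∪ innerBoundary (zdGraph d) (box d a)) : Set (Site d)) t s →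
          ω ∈ openConnIn (↑((box d (l * a) \ box d a) ∪ innerBoundary (zdGraph d) (box d a)) : Set (Site d)) t' s' →
          ω ∈ openConnIn (↑((box d (l * a) \ box d a) ∪ innerBoundary (zdGraph d) (box d a)) : Set (Site d)) s s'}))
    (hUAD : ∀ ε : ℝ, 0 < ε → ∃ K₀ : ℕ, ∀ m : ℕ, 1 ≤ m → ∀ N : ℕ, K₀ * m ≤ N →
      (bondPercolation (zdGraph d) (criticalProbI d)).real (boxCrossing d m N) ≤ ε) :
    ∃ (n₀ : ℕ) (c : ℝ), 1 ≤ n₀ ∧ 0 < c ∧ ∀ (ν : Measure (BondConfig (Site d))) [IsFiniteMeasure ν],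
      (∀ (F : Finset (Sym2 (Site d))) (E : Set (BondConfig (Site d))), MeasurableSet E → DeterminedBy E ↑F →
        Tendsto (fun n : ℕ => (bondPercolation (zdGraph d) (criticalProbI d)).real (E ∩ siteToBoundary d n) /
          oneArmProb d (criticalProbI d) n) atTop (𝓝 (ν.real E))) →
      ∀ (b n : ℕ), 1 ≤ b → n₀ * b ≤ n → ∀ (H : Set (BondConfig (Site d))), IsLocalEvent H →
        (∀ ω ω' : BondConfig (Site d), ω ⊆ (zdGraph d).edgeSet → ω' ⊆ (zdGraph d).edgeSet →
          (∀ z, ω ∈ openConnIn (↑(box d b) : Set (Site d)) 0 z ↔ ω' ∈ openConnIn (↑(box d b) : Set (Site d)) 0 z) →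
          (∀ x z, ω ∈ openConnIn (↑(box d b) : Set (Site d)) 0 x → z ∈ box d (b + 1) → (s(x, z) ∈ ω ↔ s(x, z) ∈ ω')) →
          ω ∈ H → ω' ∈ H) →
        ∀ S : Finset (Site d), (∀ z ∈ S, n ≤ Site.supNorm z ∧ Site.supNorm z ≤ 2 * n) →
          cU * (c * oneArmProb d (criticalProbI d) n) ^ S.card * ν.real H ≤
            ν.real (H ∩ ⋂ z ∈ S, (openConnIn (↑(box d (4 * l * n)) : Set (Site d)) (0 : Site d) z : Set (BondConfig (Site d)))) := by
  have hd1 : 1 ≤ d := le_trans (by norm_num) hd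
  obtain ⟨B, hB, hR2⟩ := Rsw3.exists_oneArmProb_ratio_of_setToSetQuasiMultAspectAt hd hs hsL hϰ hA2
  have hp : 0 < ((criticalProbI d : unitInterval) : ℝ) := by
    rw [coe_criticalProbI]; exact criticalProb_zd_pos d hd1
  have hπ : ∀ m : ℕ, 0 < oneArmProb d (criticalProbI d) m := fun m => oneArmProb_pos hd1 _ hp m
  have hBl : 0 < B ^ (l + 1) := pow_pos hB _
  have hRl : ∀ j m : ℕ, 1 ≤ j → j ≤ m → m ≤ 4 * (l + 1) * j →
      oneArmProb d (criticalProbI d) j ≤ B ^ (l + 1) * oneArmProb d (criticalProbI d) m := fun j m hj hjm hm =>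
    oneArmProb_ratio_iter _ hR2 hπ (l + 1) j m hj hjm (hm.trans (Nat.mul_le_mul_right j (four_mul_succ_le_eight_pow l)))
  obtain ⟨K₀, hK₀⟩ := hUAD (1 / (2 * (B ^ (l + 1)) ^ 2)) (by positivity)
  have hεB : 1 / (2 * (B ^ (l + 1)) ^ 2) * (B ^ (l + 1)) ^ 2 ≤ 1 / 2 := le_of_eq (by field_simp)
  refine ⟨32 * (K₀ + 3), 1 / (2 * B ^ (l + 1) * B), by omega, by positivity, fun ν _ hν b n hb hn H hHl hH S hS => ?_⟩
  obtain ⟨hbu, hKb, h32, h2n, h4n⟩ := div32_scale_bounds (K₀ := K₀) hb hn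
  set u : ℕ := (n - 1) / 32 with hu
  have hn1 : 1 ≤ n := by omega
  have hSu : S ⊆ box d (128 * u) \ box d (32 * u) := by
    intro z hz
    obtain ⟨hz1, hz2⟩ := hS z hz
    rw [Finset.mem_sdiff, mem_box_iff_supNorm_le, mem_box_iff_supNorm_le]
    omega
  have h := mul_iicMeasure_real_inter_biInter_le_of_saturated (criticalProbI d) hl hcU.le hCU hBl hεB hK₀ hRl hν hb hbu hKb hHl hH S hSu
  -- `π(128u) ≥ π(4n) ≥ π(n)/B` and `Λ(128lu) ⊆ Λ(4ln)`
  have hπmono : oneArmProb d (criticalProbI d) (4 * n) ≤ oneArmProb d (criticalProbI d) (128 * u) :=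
    real_siteToBoundary_antitone _ h4n
  have hratio : oneArmProb d (criticalProbI d) n ≤ B * oneArmProb d (criticalProbI d) (4 * n) :=
    hR2 n (4 * n) hn1 (by omega) (by omega)
  have hπn : oneArmProb d (criticalProbI d) n ≤ B * oneArmProb d (criticalProbI d) (128 * u) :=
    hratio.trans (mul_le_mul_of_nonneg_left hπmono hB.le)
  have hfac : 1 / (2 * B ^ (l + 1) * B) * oneArmProb d (criticalProbI d) n ≤
      oneArmProb d (criticalProbI d) (128 * u) / (2 * B ^ (l + 1)) :=
    calc 1 / (2 * B ^ (l + 1) * B) * oneArmProb d (criticalProbI d) n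
        ≤ 1 / (2 * B ^ (l + 1) * B) * (B * oneArmProb d (criticalProbI d) (128 * u)) :=
          mul_le_mul_of_nonneg_left hπn (by positivity)
      _ = oneArmProb d (criticalProbI d) (128 * u) / (2 * B ^ (l + 1)) := by
          field_simp
  have hc0 : 0 ≤ 1 / (2 * B ^ (l + 1) * B) * oneArmProb d (criticalProbI d) n := mul_nonneg (by positivity) (hπ n).le
  have hbox : (↑(box d (l * (128 * u))) : Set (Site d)) ⊆ ↑(box d (4 * l * n)) :=
    Finset.coe_subset.2 (box_mono d (by nlinarith))
  have hsub : H ∩ (⋂ z ∈ S, (openConnIn (↑(box d (l * (128 * u))) : Set (Site d)) (0 : Site d) z : Set (BondConfig (Site d)))) ⊆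
      H ∩ ⋂ z ∈ S, (openConnIn (↑(box d (4 * l * n)) : Set (Site d)) (0 : Site d) z : Set (BondConfig (Site d))) :=
    Set.inter_subset_inter_right _ (Set.iInter₂_mono fun z _ => openConnIn_mono hbox 0 z)
  calc cU * (1 / (2 * B ^ (l + 1) * B) * oneArmProb d (criticalProbI d) n) ^ S.card * ν.real H
      ≤ cU * (oneArmProb d (criticalProbI d) (128 * u) / (2 * B ^ (l + 1))) ^ S.card * ν.real H :=
        mul_le_mul_of_nonneg_right (mul_le_mul_of_nonneg_left
          (pow_le_pow_left₀ hc0 hfac _) hcU.le) measureReal_nonneg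
    _ ≤ _ := h
    _ ≤ _ := measureReal_mono hsub

/-- **THE k-POINT FUNCTION OF KESTEN'S IIC AT ONE SCALE ON `ℤ^d`** (`p_c(ℤ^d)`, `d ≥ 2`; (A2)□(s,L) + `CU⁺_l` + UAD): there are `n₀ ≥ 1`
and `c > 0` such that for every finite measure `ν` with Kesten's IIC limit property, every `n ≥ n₀` and EVERY finite set of sites `S`
with `n ≤ ‖z‖_∞ ≤ 2n` (`z ∈ S`): **`c_U · (c·π_{p_c}(n))^{#S} · ν(univ) ≤ ν(S ⊆ C(0))`** — any `k` sites at one scale belong to the IIC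
together with probability at least `c_U (cπ(n))^k`, whatever their mutual distances (the matching upper bound `(Cπ(n))^k` needs
separated sites).  Companion of gen 19's factorisation ACROSS scales. [cite: Kesten1986, Thm. (8)] [cite: BasuSapozhnikov2017ECP, Thm. 1.1] -/
theorem exists_iicMeasure_real_biInter_openConn_ge_criticalProbI (hd : 2 ≤ d) {s L : ℕ} (hs : 2 ≤ s) (hsL : s ≤ L)
    {ϰ : ℝ} (hϰ : 0 < ϰ) (hA2 : SetToSetQuasiMultAspectAt d (criticalProbI d) s L ϰ) {l : ℕ} (hl : 2 ≤ l) {cU : ℝ} (hcU : 0 < cU)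
    (hCU : ∀ a : ℕ, 1 ≤ a → ∀ E : Set (BondConfig (Site d)), IsUpperSet E → MeasurableSet E →
      cU * (bondPercolation (zdGraph d) (criticalProbI d)).real E ≤ (bondPercolation (zdGraph d) (criticalProbI d)).real (E ∩
        {ω : BondConfig (Site d) | ∀ t ∈ innerBoundary (zdGraph d) (box d a), ∀ s ∈ innerBoundary (zdGraph d) (box d (l * a)),
          ∀ t' ∈ innerBoundary (zdGraph d) (box d a), ∀ s' ∈ innerBoundary (zdGraph d) (box d (l * a)),
          ω ∈ openConnIn (↑((box d (l * a) \ box d a) ∪ innerBoundary (zdGraph d) (box d a)) : Set (Site d)) t s →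
          ω ∈ openConnIn (↑((box d (l * a) \ box d a) ∪ innerBoundary (zdGraph d) (box d a)) : Set (Site d)) t' s' →
          ω ∈ openConnIn (↑((box d (l * a) \ box d a) ∪ innerBoundary (zdGraph d) (box d a)) : Set (Site d)) s s'}))
    (hUAD : ∀ ε : ℝ, 0 < ε → ∃ K₀ : ℕ, ∀ m : ℕ, 1 ≤ m → ∀ N : ℕ, K₀ * m ≤ N →
      (bondPercolation (zdGraph d) (criticalProbI d)).real (boxCrossing d m N) ≤ ε) :
    ∃ (n₀ : ℕ) (c : ℝ), 1 ≤ n₀ ∧ 0 < c ∧ ∀ (ν : Measure (BondConfig (Site d))) [IsFiniteMeasure ν],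
      (∀ (F : Finset (Sym2 (Site d))) (E : Set (BondConfig (Site d))), MeasurableSet E → DeterminedBy E ↑F →
        Tendsto (fun n : ℕ => (bondPercolation (zdGraph d) (criticalProbI d)).real (E ∩ siteToBoundary d n) /
          oneArmProb d (criticalProbI d) n) atTop (𝓝 (ν.real E))) →
      ∀ n : ℕ, n₀ ≤ n → ∀ S : Finset (Site d), (∀ z ∈ S, n ≤ Site.supNorm z ∧ Site.supNorm z ≤ 2 * n) →
        cU * (c * oneArmProb d (criticalProbI d) n) ^ S.card * ν.real Set.univ ≤
          ν.real (⋂ z ∈ S, (openConn (0 : Site d) z : Set (BondConfig (Site d)))) := by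
  obtain ⟨n₀, c, hn₀, hc, h⟩ := exists_iicMeasure_real_inter_biInter_openConnIn_ge_criticalProbI hd hs hsL hϰ hA2 hl hcU hCU hUAD
  refine ⟨n₀, c, hn₀, hc, fun ν _ hν n hn S hS => ?_⟩
  have hsat : ∀ ω ω' : BondConfig (Site d), ω ⊆ (zdGraph d).edgeSet → ω' ⊆ (zdGraph d).edgeSet →
      (∀ z, ω ∈ openConnIn (↑(box d 1) : Set (Site d)) 0 z ↔ ω' ∈ openConnIn (↑(box d 1) : Set (Site d)) 0 z) →
      (∀ x z, ω ∈ openConnIn (↑(box d 1) : Set (Site d)) 0 x → z ∈ box d (1 + 1) → (s(x, z) ∈ ω ↔ s(x, z) ∈ ω')) →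
      ω ∈ (Set.univ : Set (BondConfig (Site d))) → ω' ∈ (Set.univ : Set (BondConfig (Site d))) :=
    fun _ _ _ _ _ _ _ => Set.mem_univ _
  have h1 := h ν hν 1 n le_rfl (by simpa using hn) Set.univ ⟨∅, Literature.Probability.Percolation.determinedBy_univ _⟩ hsat S hS
  rw [Set.univ_inter] at h1
  refine h1.trans (measureReal_mono (Set.iInter₂_mono fun z _ => ?_))
  rw [Literature.Barriers.CriticalPhenomena.openConn_zero_eq_iUnion_openConnIn z]
  exact Set.subset_iUnion (fun m : ℕ => (openConnIn (↑(box d m) : Set (Site d)) (0 : Site d) z : Set (BondConfig (Site d)))) _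

end Summit.CriticalPhenomena.PercolationContinuityZ3.Theorems.Crossing

end
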